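import Literature.Probability.LatticeModels.SahiThirdOrderCorrelation
import Mathlib.Tactic.Ring
import Mathlib.Tactic.Linarith
import HarnessLib

/-!
# `NoHeavyLowerTail` (stmt-CriticalPhenomena-4575) — the two-covariance form of Sahi's `E₃`

Support file (prover prim-ineq-gen-5 gen 6, new-inequality factory seat; `--supports stmt-CriticalPhenomena-4575`).

For ANY measure `μ` and ANY three events `A, B, C`, Sahi's third-order functional
`E₃(A,B,C) = 2μ(ABC) + μ(A)μ(B)μ(C) − Σ_cyc μ(A)μ(BC)` is, identically,
`E₃(A,B,C) = Cov(1_B, 1_{A∩C}) + Cov(1_C, 1_{A∩B}) − μ(A)·Cov(1_B, 1_C)`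
(`sahiE3_eq_cov_add_cov_sub_mul_cov`; a one-line `ring` identity, stated with the covariances written out as
`μ(A∩B∩C) − μ(B)μ(A∩C)` etc.).  Consequently `0 ≤ E₃(A,B,C)` is EQUIVALENT to the 'quantitative Harris' comparison
`μ(A)·Cov(1_B,1_C) ≤ Cov(1_B,1_{A∩C}) + Cov(1_C,1_{A∩B})` (`sahiE3_nonneg_iff_mul_cov_le`).  This is the form in
which the seat attacks the E3GRP row `r3 = E₃(D[x|b], D[x|W], D[b|y])` of the `|A| = 5` step (memo
run/shared/lean/prim/prim-ineq-gen-5/FINDINGS-gen5-g6.md §G6-3: both covariances on the right have two-copy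
'connected only through the other copy's cluster' representations, the one on the left is a Harris covariance of two
decreasing events).  Nothing here is specific to percolation.
-/

namespace Summit.CriticalPhenomena.PercolationContinuityZ3.Theorems

open MeasureTheory
open Literature.Probability.LatticeModels (sahiE3 sahiE3_def)

variable {Ω : Type*} [MeasurableSpace Ω] (μ : Measure Ω)

/-- **Two-covariance form of `E₃`.** For any measure and any events,
`E₃(A,B,C) = (μ(A∩B∩C) − μ(B)·μ(A∩C)) + (μ(A∩B∩C) − μ(C)·μ(A∩B)) − μ(A)·(μ(B∩C) − μ(B)·μ(C))`. [folklore] -/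
theorem sahiE3_eq_cov_add_cov_sub_mul_cov (A B C : Set Ω) :
    sahiE3 μ A B C = (μ.real (A ∩ B ∩ C) - μ.real B * μ.real (A ∩ C))
      + (μ.real (A ∩ B ∩ C) - μ.real C * μ.real (A ∩ B))
      - μ.real A * (μ.real (B ∩ C) - μ.real B * μ.real C) := by
  rw [sahiE3_def]
  ring

/-- **`E₃ ≥ 0` as a quantitative Harris comparison.** For any measure and any events,
`0 ≤ E₃(A,B,C) ↔ μ(A)·(μ(B∩C) − μ(B)μ(C)) ≤ (μ(A∩B∩C) − μ(B)μ(A∩C)) + (μ(A∩B∩C) − μ(C)μ(A∩B))`. [folklore] -/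
theorem sahiE3_nonneg_iff_mul_cov_le (A B C : Set Ω) :
    0 ≤ sahiE3 μ A B C ↔
      μ.real A * (μ.real (B ∩ C) - μ.real B * μ.real C) ≤
        (μ.real (A ∩ B ∩ C) - μ.real B * μ.real (A ∩ C))
          + (μ.real (A ∩ B ∩ C) - μ.real C * μ.real (A ∩ B)) := by
  rw [sahiE3_eq_cov_add_cov_sub_mul_cov, sub_nonneg]


/-! ### The 'glued-hub' form: when `Aᶜ ∩ B ⊆ C`

For the group-separation triple `A = D[x|b]`, `B = D[x|W]`, `C = D[b|y]` with `y ∈ W` one has `Aᶜ ∩ B ⊆ C`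
(`x ~ b` and `x ≁ W` force `b ≁ y`).  Under this single set inclusion `E₃` takes the form (♦) of the memo:
`E₃(A,B,C) = (1 + μ(Aᶜ))·Cov(1_B,1_C) + μ(Aᶜ∩Bᶜ∩C)·μ(B) − μ(Aᶜ∩B)·(μ(Bᶜ) + μ(Cᶜ))`, so that `E₃ ≥ 0` is the
quantitative Harris bound `Cov(1_B,1_C) ≥ [μ(Aᶜ∩B)(μ(Bᶜ)+μ(Cᶜ)) − μ(Aᶜ∩Bᶜ∩C)μ(B)] / (1 + μ(Aᶜ))`. -/

section GluedHub

variable [IsProbabilityMeasure μ] {A B C : Set Ω}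

/-- **Glued-hub form of `E₃`.** If `Aᶜ ∩ B ⊆ C` then
`E₃(A,B,C) = (1 + μ(Aᶜ))·(μ(B∩C) − μ(B)μ(C)) + μ(Aᶜ ∩ Bᶜ ∩ C)·μ(B) − μ(Aᶜ ∩ B)·(μ(Bᶜ) + μ(Cᶜ))`
for every probability measure. [this work] -/
theorem sahiE3_eq_of_compl_inter_subset (hA : MeasurableSet A) (hB : MeasurableSet B) (hC : MeasurableSet C)
    (hsub : Aᶜ ∩ B ⊆ C) :
    sahiE3 μ A B C = (1 + μ.real Aᶜ) * (μ.real (B ∩ C) - μ.real B * μ.real C)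
      + μ.real (Aᶜ ∩ Bᶜ ∩ C) * μ.real B - μ.real (Aᶜ ∩ B) * (μ.real Bᶜ + μ.real Cᶜ) := by
  -- linear relations between the masses
  have s1 : B ∩ C ∩ A = A ∩ B ∩ C := by
    ext ω; simp only [Set.mem_inter_iff]; tauto
  have s2 : (B ∩ C) \ A = Aᶜ ∩ B := by
    ext ω
    simp only [Set.mem_sdiff, Set.mem_inter_iff, Set.mem_compl_iff]
    constructor
    · rintro ⟨⟨hb, _⟩, ha⟩; exact ⟨ha, hb⟩
    · rintro ⟨ha, hb⟩; exact ⟨⟨hb, hsub ⟨ha, hb⟩⟩, ha⟩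
  have s3 : B ∩ A = A ∩ B := Set.inter_comm B A
  have s4 : B \ A = Aᶜ ∩ B := by
    ext ω; simp only [Set.mem_sdiff, Set.mem_inter_iff, Set.mem_compl_iff]; tauto
  have s5 : C ∩ A = A ∩ C := Set.inter_comm C A
  have s6 : (C \ A) ∩ B = Aᶜ ∩ B := by
    ext ω
    simp only [Set.mem_sdiff, Set.mem_inter_iff, Set.mem_compl_iff]
    constructor
    · rintro ⟨⟨_, ha⟩, hb⟩; exact ⟨ha, hb⟩
    · rintro ⟨ha, hb⟩; exact ⟨⟨hsub ⟨ha, hb⟩, ha⟩, hb⟩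
  have s7 : (C \ A) \ B = Aᶜ ∩ Bᶜ ∩ C := by
    ext ω; simp only [Set.mem_sdiff, Set.mem_inter_iff, Set.mem_compl_iff]; tauto
  have h1 : μ.real (B ∩ C ∩ A) + μ.real ((B ∩ C) \ A) = μ.real (B ∩ C) := measureReal_inter_add_sdiff hA
  have h2 : μ.real (B ∩ A) + μ.real (B \ A) = μ.real B := measureReal_inter_add_sdiff hA
  have h3 : μ.real (C ∩ A) + μ.real (C \ A) = μ.real C := measureReal_inter_add_sdiff hA
  have h4 : μ.real ((C \ A) ∩ B) + μ.real ((C \ A) \ B) = μ.real (C \ A) := measureReal_inter_add_sdiff hB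
  rw [s1, s2] at h1
  rw [s3, s4] at h2
  rw [s5] at h3
  rw [s6, s7] at h4
  have hAc : μ.real Aᶜ = 1 - μ.real A := by rw [measureReal_compl hA, probReal_univ]
  have hBc : μ.real Bᶜ = 1 - μ.real B := by rw [measureReal_compl hB, probReal_univ]
  have hCc : μ.real Cᶜ = 1 - μ.real C := by rw [measureReal_compl hC, probReal_univ]
  rw [sahiE3_def, hAc, hBc, hCc]
  linear_combination (2 : ℝ) * h1 - μ.real C * h2 - μ.real B * h3 - μ.real B * h4

/-- **`E₃ ≥ 0` as a quantitative Harris lower bound** (glued-hub form): if `Aᶜ ∩ B ⊆ C` then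
`0 ≤ E₃(A,B,C) ↔ μ(Aᶜ∩B)·(μ(Bᶜ)+μ(Cᶜ)) − μ(Aᶜ∩Bᶜ∩C)·μ(B) ≤ (1 + μ(Aᶜ))·(μ(B∩C) − μ(B)μ(C))`. [this work] -/
theorem sahiE3_nonneg_iff_of_compl_inter_subset (hA : MeasurableSet A) (hB : MeasurableSet B)
    (hC : MeasurableSet C) (hsub : Aᶜ ∩ B ⊆ C) :
    0 ≤ sahiE3 μ A B C ↔
      μ.real (Aᶜ ∩ B) * (μ.real Bᶜ + μ.real Cᶜ) - μ.real (Aᶜ ∩ Bᶜ ∩ C) * μ.real B ≤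
        (1 + μ.real Aᶜ) * (μ.real (B ∩ C) - μ.real B * μ.real C) := by
  rw [sahiE3_eq_of_compl_inter_subset μ hA hB hC hsub]
  constructor <;> intro h <;> linarith

end GluedHub

end Summit.CriticalPhenomena.PercolationContinuityZ3.Theorems
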